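/-
Copyright (c) 2026 the pub-hodgecm-mathlib formalisation cell (harness21).  Prover seat hodgecm-mathlib-LH5-p04 (g10), 2026-09-03.  E1 row 43 «SS LEVEL GROUPS ARE COMPACT
OPEN AND SHRINK TO `1`» (E1 keeper ∕ dealer F0P3a-p03 (g29) 01:50:15Z; census author F0P3a-p04 (g31) (A1)(b)–(d) datum half + (U1) «compact OPEN» datum cost of (A5)).
-/
import Literature.NumberTheory.Automorphic.UnitaryLatticeTreeLevelGroups       -- ★ row 22 p853121 (this lineage): (U1) `exists_subgroup_mem_iff_…`, `mapGL_latt_eq_of_map_sub_one_le_scaleLattice`, (U2) `map_sub_one_le_scaleLattice_pow_of_le`; brings ★ LevelShift `map_sub_one_latt_le_scaleLattice_iff`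
import Literature.NumberTheory.Automorphic.UnitaryLatticeTreeStabilizer        -- ★ `mapGL_latt_eq_latt_iff` (the stabiliser test `γ·latt g = latt g ↔ g⁻¹γg, g⁻¹γ⁻¹g` integral)
import Literature.NumberTheory.Automorphic.HyperspecialUnitaryCompactOpen      -- ★ `isCompact_generalLinearIntegral` (`{g : g, g⁻¹ integral}` compact when `𝒪` is), ★ `isClosed_unitaryGroupOfForm`
import Mathlib.GroupTheory.ArchimedeanDensely
import Mathlib.Topology.Algebra.OpenSubgroup
import HarnessLib

/-!
# The lattice graph of a hermitian space — THE SCHNEIDER–STUHLER LEVEL GROUPS `U_M^{(e)}` OF A LATTICE ARE COMPACT OPEN AND SHRINK TO `1`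

Topic `NumberTheory/Automorphic`; namespace `Literature.NumberTheory.Automorphic.UnitaryLatticeTree` (T1a currency of ★ `UnitaryLatticeTreeDefs`: `[Valued K ℤᵐ⁰]`, lattices
`M : Submodule 𝒪[K] (Fin N → K)`, `mapGL g M = g·M`, `scaleLattice c M = c·M`, `latt g = g·𝒪^N`).  THEOREMS ONLY (no definition, no instance, no notation, no named fact,
no `sorry`); any `N`, any valued field `K` (`𝒪[K]` compact where compactness is claimed — the standing datum hypothesis of ★ `UnitaryLatticeTreeLevelIndices` §2), any
`M = latt g₀` (`g₀ ∈ GL_N(K)`).  Sibling of ★ row 22 `UnitaryLatticeTreeLevelGroups` (the algebra (U1)–(U4)); this file is the TOPOLOGY.  Cell `pub/hodgecm-mathlib` (D-0151),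
crux H413 = `stmt-HodgeConjecture-24833`; E1 row 43 of the E1 RESIDUE MATRIX (keeper F0P3a-p03 (g29) 01:50:15Z: «(i) `U_M^{(e)}` is OPEN and COMPACT in `GL (Fin N) K` for a lattice
`M = latt g₀`; (ii) NEIGHBOURHOOD BASIS: every open `W ∋ 1` contains some `U_M^{(e)}`; (iii) hence for any finite family of opens and any `e₀` some `U_M^{(e)}`, `e ≥ e₀`, sits inside
all of them; (iv) the unitary restriction inherits (i)–(iii)»).  Seat LH5-p04 (g10).  HONEST LABEL: count-neutral generic base layer of the (R-SS) resolution engine ((U1) + (A1)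
datum costs of census E1); HC_CM is proved only modulo the 2 remaining named inputs (hLiu418 24832, h413 24833) until rung 0 closes; nothing printed is asserted here.

THE LEVEL TOKEN (as in ★ row 22, INLINE, never named): `LEV(M, c, g) :≡ M.map ((Matrix.toLin' ((g : Matrix (Fin N) (Fin N) K) - 1)).restrictScalars 𝒪[K]) ≤ scaleLattice c M`
(«`(g − 1)·M ⊆ c·M`»); the Schneider–Stuhler level group of `x = [M]` at depth `e` is the SET `{g | g·M = M ∧ LEV(M, ϖ^e, g)}` [SS97, I.2], and on `M = latt g₀` with `0 < |c| < 1`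
the stabiliser clause is automatic (★ row 22 `mapGL_latt_eq_of_map_sub_one_le_scaleLattice`), so both spellings are served; subgroup-OBJECT consumers use the hypothesis style
`hU : ∀ g, g ∈ U ↔ …` of ★ row 22 §1.  THE TWO DICTIONARIES everything rests on: ★ `mapGL_latt_eq_latt_iff` (`γ·latt g₀ = latt g₀ ↔ g₀⁻¹γg₀` and `g₀⁻¹γ⁻¹g₀` integral) and ★
`map_sub_one_latt_le_scaleLattice_iff` (`LEV(latt g₀, c, γ) ↔ ∀ i k, |(g₀⁻¹γg₀ − 1)_{ik}| ≤ |c|`) — entrywise conditions, continuous in `γ`.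

* §1 OPEN (any valued field): `isOpen_setOf_mapGL_latt_eq` (the stabiliser `Stab(latt g₀)` is open), `isOpen_setOf_map_sub_one_latt_le_scaleLattice` (the pure level set, `c ≠ 0`),
  `isOpen_coe_of_mem_iff_mapGL_latt_eq_and_map_sub_one_le_scaleLattice` ∕ `isOpen_coe_of_mem_iff_map_sub_one_latt_le_scaleLattice` (the hypothesis-style subgroups).
* §2 COMPACT (`𝒪` compact): `isCompact_setOf_mapGL_latt_eq` (`Stab(latt g₀) = g₀·{g : g, g⁻¹ integral}·g₀⁻¹`, ★ `isCompact_generalLinearIntegral`),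
  `isCompact_setOf_map_sub_one_latt_le_scaleLattice` (`0 < |c| < 1`: a closed — open subgroup — subset of the stabiliser), the two subgroup spellings.
* §3 SHRINK TO `1` (`𝒪` compact, `0 < |ϖ| < 1`): `eq_one_of_forall_map_sub_one_latt_le_scaleLattice_pow` (`⋂_e U_M^{(e)} = {1}`: an entry of valuation `≤ |ϖ|^e` for every `e`
  is `0`, ★ `exists_pow_lt₀`), **`exists_forall_map_sub_one_latt_le_scaleLattice_pow_imp_mem`** (NEIGHBOURHOOD BASIS: every open `W ∋ 1` contains `U_M^{(e)}` for some `e ≥ e₀` —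
  Cantor's intersection theorem ★ `IsCompact.elim_directed_family_closed` on the compact `U_M^{(1)}` and the decreasing closed `U_M^{(e+1)} ∖ W`), `…_of_mem_nhds` (filter form),
  `…_forall_of_finite` (finite family of opens, (iii)).
* §4 THE UNITARY RESTRICTION (`σ` continuous for compactness): `isOpen_preimage_val_…`, `isCompact_preimage_val_…` (closed embedding `U(σ,H) ↪ GL_N(K)`, ★ `isClosed_unitaryGroupOfForm`),
  `exists_forall_…_imp_mem_unitary` (the basis pulled back: an open `W ∋ 1` of `U(σ,H)` is the trace of an open of `GL_N(K)`), `isOpen_coe_∕isCompact_coe_of_mem_iff_…_unitary`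
  (hypothesis-style subgroups of `U(σ,H)`).
DEDUP: the `ValuativeRel`∕local-field cousins ★ `congruenceGL` (`isOpen_congruenceGL`, `isCompact_congruenceGL`, `exists_congruenceGL_subset`, `nonarchimedeanGroup_gl`; `M = 𝒪^N`
only) and ★ `isCompact_isOpen_comap_congruenceGL` (`U(σ,J)`, `N = 3`) are cited, not restated: this file is the `[Valued K ℤᵐ⁰]` lattice-model statement for an ARBITRARY vertex
`M = latt g₀`, which is what the (R-SS) rows consume (41c `Subgroup.exists_aux_subgroup_of_eventually_eq`'s `𝒲`, `P`; (U6)(U7)); ★ (G0) `UnitaryLatticeTreeLevelIndices` §2 treats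
the STABILISERS `K₀, K₁, I` inside `U`, not the level groups.

## References
* [SchneiderStuhler1997] P. Schneider, U. Stuhler, *Representation theory and sheaves on the Bruhat–Tits building*, Publ. Math. IHÉS 85 (1997): Ch. I §2 (the groups `U_σ^{(e)}`:
  compact open, (U1)–(U4), a fundamental system of neighbourhoods of `1`).
* [Korman2004] J. Korman, *On the local constancy of characters*, arXiv:math/0409292: §3.6, §5 Claim 39 (the auxiliary level group inside finitely many opens).
* [Serre1980Trees] J.-P. Serre, *Trees* (1980): Ch. II §1.1–1.2 (lattices, stabilisers `g GL_N(𝒪) g⁻¹`, congruence level).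
* [BruhatTits1972] F. Bruhat, J. Tits, *Groupes réductifs sur un corps local* I, Publ. Math. IHÉS 41 (1972): §10 (lattice description of the building of a classical group).
* [Tits1979] J. Tits, *Reductive groups over local fields*, PSPM 33.1 (1979): §3.2 (compact open stabilisers).
-/

set_option autoImplicit false

noncomputable section

open scoped Valued WithZero Matrix MatrixGroups Topology

namespace Literature.NumberTheory.Automorphic.UnitaryLatticeTree

open Literature.NumberTheory.Automorphic Literature.NumberTheory.Automorphic.HermitianLattice

variable {K : Type*} [Field K] [Valued K ℤᵐ⁰] {N : ℕ}

/-! ## §1 OPEN: the stabiliser of `latt g₀` and its level sets are open in `GL_N(K)` -/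

/-- Conjugation `γ ↦ g₀⁻¹ γ g₀` read in matrices is continuous on `GL_N(K)`. [cite: Serre1980Trees, Ch. II §1.1] -/
theorem continuous_coe_inv_mul_mul (g₀ : GL (Fin N) K) :
    Continuous fun γ : GL (Fin N) K => ((g₀⁻¹ * γ * g₀ : GL (Fin N) K) : Matrix (Fin N) (Fin N) K) :=
  Units.continuous_val.comp ((continuous_const.mul continuous_id).mul continuous_const)

/-- … and so is `γ ↦ (g₀⁻¹ γ g₀)⁻¹` read in matrices. [cite: Serre1980Trees, Ch. II §1.1] -/
theorem continuous_coe_inv_inv_mul_mul (g₀ : GL (Fin N) K) :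
    Continuous fun γ : GL (Fin N) K => (((g₀⁻¹ * γ * g₀)⁻¹ : GL (Fin N) K) : Matrix (Fin N) (Fin N) K) :=
  Units.continuous_coe_inv.comp ((continuous_const.mul continuous_id).mul continuous_const)

/-- **THE STABILISER `Stab(latt g₀) = {γ : γ·latt g₀ = latt g₀}` IS OPEN in `GL_N(K)`**: by ★ `mapGL_latt_eq_latt_iff` it is cut out by the `2N²` conditions «the entries of
`g₀⁻¹γg₀` and of `(g₀⁻¹γg₀)⁻¹` lie in the (open) valuation ring», each continuous in `γ`. [cite: Serre1980Trees, Ch. II §1.1–1.2] [cite: Tits1979, §3.2] -/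
theorem isOpen_setOf_mapGL_latt_eq (g₀ : GL (Fin N) K) :
    IsOpen {γ : GL (Fin N) K | mapGL γ (latt (g₀ : Matrix (Fin N) (Fin N) K)) = latt (g₀ : Matrix (Fin N) (Fin N) K)} := by
  have hset : {γ : GL (Fin N) K | mapGL γ (latt (g₀ : Matrix (Fin N) (Fin N) K)) = latt (g₀ : Matrix (Fin N) (Fin N) K)} =
      (⋂ i, ⋂ j, (fun γ : GL (Fin N) K => ((g₀⁻¹ * γ * g₀ : GL (Fin N) K) : Matrix (Fin N) (Fin N) K) i j) ⁻¹' {x : K | Valued.v x ≤ 1}) ∩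
        ⋂ i, ⋂ j, (fun γ : GL (Fin N) K => (((g₀⁻¹ * γ * g₀)⁻¹ : GL (Fin N) K) : Matrix (Fin N) (Fin N) K) i j) ⁻¹' {x : K | Valued.v x ≤ 1} := by
    ext γ
    have hconj : (g₀⁻¹ * γ⁻¹ * g₀ : GL (Fin N) K) = (g₀⁻¹ * γ * g₀)⁻¹ := by group
    simp only [Set.mem_setOf_eq, mapGL_latt_eq_latt_iff, IsIntMatrix, hconj, Set.mem_inter_iff, Set.mem_iInter, Set.mem_preimage]
  rw [hset]
  have hO : IsOpen {x : K | Valued.v x ≤ 1} := Valued.isOpen_integer K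
  exact (isOpen_iInter_of_finite fun i => isOpen_iInter_of_finite fun j => hO.preimage ((continuous_coe_inv_mul_mul g₀).matrix_elem i j)).inter
    (isOpen_iInter_of_finite fun i => isOpen_iInter_of_finite fun j => hO.preimage ((continuous_coe_inv_inv_mul_mul g₀).matrix_elem i j))

/-- `|x| ≤ |c| ↔ |c⁻¹ x| ≤ 1` (`c ≠ 0`) — the closed ball of radius `|c|` read through the valuation ring. [cite: Serre1980Trees, Ch. II §1.1] -/
theorem v_le_v_iff_v_inv_mul_le_one {c : K} (hc : c ≠ 0) (x : K) : Valued.v x ≤ Valued.v c ↔ Valued.v (c⁻¹ * x) ≤ 1 := by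
  have hvc : Valued.v c ≠ 0 := (Valuation.ne_zero_iff _).2 hc
  rw [map_mul, map_inv₀]
  constructor
  · intro h
    calc (Valued.v c)⁻¹ * Valued.v x ≤ (Valued.v c)⁻¹ * Valued.v c := mul_le_mul_right h _
      _ = 1 := inv_mul_cancel₀ hvc
  · intro h
    calc Valued.v x = Valued.v c * ((Valued.v c)⁻¹ * Valued.v x) := by rw [← mul_assoc, mul_inv_cancel₀ hvc, one_mul]
      _ ≤ Valued.v c * 1 := mul_le_mul_right h _
      _ = Valued.v c := mul_one _

/-- **THE PURE LEVEL SET `{γ : (γ − 1)·latt g₀ ⊆ c·latt g₀}` IS OPEN in `GL_N(K)`** (`c ≠ 0`): by ★ `map_sub_one_latt_le_scaleLattice_iff` it is cut out by the `N²` conditions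
`|(g₀⁻¹γg₀ − 1)_{ik}| ≤ |c|`, i.e. `c⁻¹(g₀⁻¹γg₀ − 1)_{ik} ∈ 𝒪`, each continuous in `γ`. [cite: SchneiderStuhler1997, Ch. I §2] [cite: Serre1980Trees, Ch. II §1.2] -/
theorem isOpen_setOf_map_sub_one_latt_le_scaleLattice {c : K} (hc : c ≠ 0) (g₀ : GL (Fin N) K) :
    IsOpen {γ : GL (Fin N) K | (latt (g₀ : Matrix (Fin N) (Fin N) K)).map ((Matrix.toLin' ((γ : Matrix (Fin N) (Fin N) K) - 1)).restrictScalars 𝒪[K]) ≤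
      scaleLattice c (latt (g₀ : Matrix (Fin N) (Fin N) K))} := by
  have hset : {γ : GL (Fin N) K | (latt (g₀ : Matrix (Fin N) (Fin N) K)).map ((Matrix.toLin' ((γ : Matrix (Fin N) (Fin N) K) - 1)).restrictScalars 𝒪[K]) ≤
        scaleLattice c (latt (g₀ : Matrix (Fin N) (Fin N) K))} =
      ⋂ i, ⋂ k, (fun γ : GL (Fin N) K => c⁻¹ * ((((g₀⁻¹ * γ * g₀ : GL (Fin N) K) : Matrix (Fin N) (Fin N) K) - 1) i k)) ⁻¹' {x : K | Valued.v x ≤ 1} := by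
    ext γ
    simp only [Set.mem_setOf_eq, map_sub_one_latt_le_scaleLattice_iff hc, v_le_v_iff_v_inv_mul_le_one hc, Set.mem_iInter, Set.mem_preimage]
  rw [hset]
  have hO : IsOpen {x : K | Valued.v x ≤ 1} := Valued.isOpen_integer K
  exact isOpen_iInter_of_finite fun i => isOpen_iInter_of_finite fun k =>
    hO.preimage (continuous_const.mul (((continuous_coe_inv_mul_mul g₀).sub continuous_const).matrix_elem i k))

/-- **THE LEVEL GROUP `U = {γ : γ·M = M ∧ (γ − 1)·M ⊆ c·M}` OF `M = latt g₀` IS OPEN** (hypothesis-style subgroup, `c ≠ 0`; ★ row 22 `exists_subgroup_mem_iff_mapGL_eq_and_map_sub_one_le_scaleLattice`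
supplies the object). [cite: SchneiderStuhler1997, Ch. I §2] [cite: BruhatTits1972, §10] -/
theorem isOpen_coe_of_mem_iff_mapGL_latt_eq_and_map_sub_one_le_scaleLattice {c : K} (hc : c ≠ 0) (g₀ : GL (Fin N) K) {U : Subgroup (GL (Fin N) K)}
    (hU : ∀ γ : GL (Fin N) K, γ ∈ U ↔ mapGL γ (latt (g₀ : Matrix (Fin N) (Fin N) K)) = latt (g₀ : Matrix (Fin N) (Fin N) K) ∧
      (latt (g₀ : Matrix (Fin N) (Fin N) K)).map ((Matrix.toLin' ((γ : Matrix (Fin N) (Fin N) K) - 1)).restrictScalars 𝒪[K]) ≤ scaleLattice c (latt (g₀ : Matrix (Fin N) (Fin N) K))) :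
    IsOpen (U : Set (GL (Fin N) K)) := by
  have hset : (U : Set (GL (Fin N) K)) = {γ : GL (Fin N) K | mapGL γ (latt (g₀ : Matrix (Fin N) (Fin N) K)) = latt (g₀ : Matrix (Fin N) (Fin N) K)} ∩
      {γ : GL (Fin N) K | (latt (g₀ : Matrix (Fin N) (Fin N) K)).map ((Matrix.toLin' ((γ : Matrix (Fin N) (Fin N) K) - 1)).restrictScalars 𝒪[K]) ≤ scaleLattice c (latt (g₀ : Matrix (Fin N) (Fin N) K))} := by
    ext γ; exact hU γ
  rw [hset]
  exact (isOpen_setOf_mapGL_latt_eq g₀).inter (isOpen_setOf_map_sub_one_latt_le_scaleLattice hc g₀)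

/-- **THE PURE LEVEL GROUP `U = {γ : (γ − 1)·latt g₀ ⊆ c·latt g₀}` IS OPEN** (hypothesis-style, `c ≠ 0`; ★ row 22 `exists_subgroup_mem_iff_map_sub_one_latt_le_scaleLattice` supplies the
object for `0 < |c| < 1`). [cite: SchneiderStuhler1997, Ch. I §2] -/
theorem isOpen_coe_of_mem_iff_map_sub_one_latt_le_scaleLattice {c : K} (hc : c ≠ 0) (g₀ : GL (Fin N) K) {U : Subgroup (GL (Fin N) K)}
    (hU : ∀ γ : GL (Fin N) K, γ ∈ U ↔
      (latt (g₀ : Matrix (Fin N) (Fin N) K)).map ((Matrix.toLin' ((γ : Matrix (Fin N) (Fin N) K) - 1)).restrictScalars 𝒪[K]) ≤ scaleLattice c (latt (g₀ : Matrix (Fin N) (Fin N) K))) :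
    IsOpen (U : Set (GL (Fin N) K)) := by
  have hset : (U : Set (GL (Fin N) K)) =
      {γ : GL (Fin N) K | (latt (g₀ : Matrix (Fin N) (Fin N) K)).map ((Matrix.toLin' ((γ : Matrix (Fin N) (Fin N) K) - 1)).restrictScalars 𝒪[K]) ≤ scaleLattice c (latt (g₀ : Matrix (Fin N) (Fin N) K))} := by
    ext γ; exact hU γ
  rw [hset]
  exact isOpen_setOf_map_sub_one_latt_le_scaleLattice hc g₀

/-! ## §2 COMPACT: the stabiliser of `latt g₀` is compact (`𝒪` compact), hence so are its level groups -/

/-- **`Stab(latt g₀) = g₀ · {g : g, g⁻¹ integral} · g₀⁻¹`** as sets (★ `mapGL_latt_eq_latt_iff`). [cite: Serre1980Trees, Ch. II §1.1–1.2] [cite: BruhatTits1972, §10] -/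
theorem setOf_mapGL_latt_eq_eq_image_conj (g₀ : GL (Fin N) K) :
    {γ : GL (Fin N) K | mapGL γ (latt (g₀ : Matrix (Fin N) (Fin N) K)) = latt (g₀ : Matrix (Fin N) (Fin N) K)} =
      (fun g : GL (Fin N) K => g₀ * g * g₀⁻¹) ''
        {g : GL (Fin N) K | (∀ i j, Valued.v ((g : Matrix (Fin N) (Fin N) K) i j) ≤ 1) ∧ ∀ i j, Valued.v (((g⁻¹ : GL (Fin N) K) : Matrix (Fin N) (Fin N) K) i j) ≤ 1} := by
  ext γ
  rw [Set.mem_setOf_eq, mapGL_latt_eq_latt_iff]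
  constructor
  · rintro ⟨h1, h2⟩
    refine ⟨g₀⁻¹ * γ * g₀, ⟨h1, ?_⟩, by group⟩
    have hconj : ((g₀⁻¹ * γ * g₀)⁻¹ : GL (Fin N) K) = g₀⁻¹ * γ⁻¹ * g₀ := by group
    rw [hconj]
    exact h2
  · rintro ⟨g, ⟨hg, hg'⟩, rfl⟩
    have h1 : (g₀⁻¹ * (g₀ * g * g₀⁻¹) * g₀ : GL (Fin N) K) = g := by group
    have h2 : (g₀⁻¹ * (g₀ * g * g₀⁻¹)⁻¹ * g₀ : GL (Fin N) K) = g⁻¹ := by group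
    rw [h1, h2]
    exact ⟨hg, hg'⟩

/-- **THE STABILISER `Stab(latt g₀)` IS COMPACT** when the valuation ring `𝒪` is compact: it is the conjugate by `g₀` of the compact `{g : g, g⁻¹ integral}`
(★ `isCompact_generalLinearIntegral`), and conjugation is continuous. [cite: Serre1980Trees, Ch. II §1.2] [cite: Tits1979, §3.2] -/
theorem isCompact_setOf_mapGL_latt_eq [CompactSpace 𝒪[K]] (g₀ : GL (Fin N) K) :
    IsCompact {γ : GL (Fin N) K | mapGL γ (latt (g₀ : Matrix (Fin N) (Fin N) K)) = latt (g₀ : Matrix (Fin N) (Fin N) K)} := by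
  rw [setOf_mapGL_latt_eq_eq_image_conj]
  exact (isCompact_generalLinearIntegral (K := K) (n := Fin N)).image ((continuous_const.mul continuous_id).mul continuous_const)

/-- **THE LEVEL GROUP WITH THE STABILISER CLAUSE IS COMPACT** (`𝒪` compact, `c ≠ 0`): an open subgroup is closed, and `U ⊆ Stab(latt g₀)` is compact.
[cite: SchneiderStuhler1997, Ch. I §2] [cite: BruhatTits1972, §10] -/
theorem isCompact_coe_of_mem_iff_mapGL_latt_eq_and_map_sub_one_le_scaleLattice [CompactSpace 𝒪[K]] {c : K} (hc : c ≠ 0) (g₀ : GL (Fin N) K) {U : Subgroup (GL (Fin N) K)}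
    (hU : ∀ γ : GL (Fin N) K, γ ∈ U ↔ mapGL γ (latt (g₀ : Matrix (Fin N) (Fin N) K)) = latt (g₀ : Matrix (Fin N) (Fin N) K) ∧
      (latt (g₀ : Matrix (Fin N) (Fin N) K)).map ((Matrix.toLin' ((γ : Matrix (Fin N) (Fin N) K) - 1)).restrictScalars 𝒪[K]) ≤ scaleLattice c (latt (g₀ : Matrix (Fin N) (Fin N) K))) :
    IsCompact (U : Set (GL (Fin N) K)) :=
  (isCompact_setOf_mapGL_latt_eq g₀).of_isClosed_subset (U.isClosed_of_isOpen (isOpen_coe_of_mem_iff_mapGL_latt_eq_and_map_sub_one_le_scaleLattice hc g₀ hU))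
    fun γ hγ => ((hU γ).1 hγ).1

/-- **THE PURE LEVEL SET `{γ : (γ − 1)·latt g₀ ⊆ c·latt g₀}` IS COMPACT** for `0 < |c| < 1` (`𝒪` compact): it is an open subgroup (★ row 22), hence closed, inside the compact
stabiliser (the stabiliser clause is automatic, ★ row 22 `mapGL_latt_eq_of_map_sub_one_le_scaleLattice`). [cite: SchneiderStuhler1997, Ch. I §2] [cite: Serre1980Trees, Ch. II §1.2] -/
theorem isCompact_setOf_map_sub_one_latt_le_scaleLattice [CompactSpace 𝒪[K]] {c : K} (hc : c ≠ 0) (hc1 : Valued.v c < 1) (g₀ : GL (Fin N) K) :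
    IsCompact {γ : GL (Fin N) K | (latt (g₀ : Matrix (Fin N) (Fin N) K)).map ((Matrix.toLin' ((γ : Matrix (Fin N) (Fin N) K) - 1)).restrictScalars 𝒪[K]) ≤
      scaleLattice c (latt (g₀ : Matrix (Fin N) (Fin N) K))} := by
  obtain ⟨U, hU⟩ := exists_subgroup_mem_iff_map_sub_one_latt_le_scaleLattice hc hc1 g₀
  have hset : {γ : GL (Fin N) K | (latt (g₀ : Matrix (Fin N) (Fin N) K)).map ((Matrix.toLin' ((γ : Matrix (Fin N) (Fin N) K) - 1)).restrictScalars 𝒪[K]) ≤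
      scaleLattice c (latt (g₀ : Matrix (Fin N) (Fin N) K))} = (U : Set (GL (Fin N) K)) := by
    ext γ; exact (hU γ).symm
  rw [hset]
  exact (isCompact_setOf_mapGL_latt_eq g₀).of_isClosed_subset (U.isClosed_of_isOpen (isOpen_coe_of_mem_iff_map_sub_one_latt_le_scaleLattice hc g₀ hU))
    fun γ hγ => mapGL_latt_eq_of_map_sub_one_le_scaleLattice hc hc1 γ g₀ ((hU γ).1 hγ)

/-- **THE PURE LEVEL GROUP IS COMPACT** (hypothesis-style subgroup, `0 < |c| < 1`, `𝒪` compact). [cite: SchneiderStuhler1997, Ch. I §2] -/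
theorem isCompact_coe_of_mem_iff_map_sub_one_latt_le_scaleLattice [CompactSpace 𝒪[K]] {c : K} (hc : c ≠ 0) (hc1 : Valued.v c < 1) (g₀ : GL (Fin N) K)
    {U : Subgroup (GL (Fin N) K)}
    (hU : ∀ γ : GL (Fin N) K, γ ∈ U ↔
      (latt (g₀ : Matrix (Fin N) (Fin N) K)).map ((Matrix.toLin' ((γ : Matrix (Fin N) (Fin N) K) - 1)).restrictScalars 𝒪[K]) ≤ scaleLattice c (latt (g₀ : Matrix (Fin N) (Fin N) K))) :
    IsCompact (U : Set (GL (Fin N) K)) := by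
  have hset : (U : Set (GL (Fin N) K)) =
      {γ : GL (Fin N) K | (latt (g₀ : Matrix (Fin N) (Fin N) K)).map ((Matrix.toLin' ((γ : Matrix (Fin N) (Fin N) K) - 1)).restrictScalars 𝒪[K]) ≤ scaleLattice c (latt (g₀ : Matrix (Fin N) (Fin N) K))} := by
    ext γ; exact hU γ
  rw [hset]
  exact isCompact_setOf_map_sub_one_latt_le_scaleLattice hc hc1 g₀

/-! ## §3 SHRINK TO `1`: `⋂_e U_M^{(e)} = {1}` and the `U_M^{(e)}` form a neighbourhood basis of `1` -/

/-- **`⋂_e U_M^{(e)} = {1}`**: an element of every level `ϖ^e` on `M = latt g₀` (`0 < |ϖ| < 1`) is `1` — each entry of `g₀⁻¹γg₀ − 1` has valuation `≤ |ϖ|^e` for all `e`, hence is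
`0` (★ `exists_pow_lt₀` in the value group `ℤᵐ⁰`). [cite: SchneiderStuhler1997, Ch. I §2] [cite: Serre1980Trees, Ch. II §1.2] -/
theorem eq_one_of_forall_map_sub_one_latt_le_scaleLattice_pow {ϖ : K} (hϖ : ϖ ≠ 0) (hϖ1 : Valued.v ϖ < 1) (g₀ : GL (Fin N) K) {γ : GL (Fin N) K}
    (h : ∀ e : ℕ, (latt (g₀ : Matrix (Fin N) (Fin N) K)).map ((Matrix.toLin' ((γ : Matrix (Fin N) (Fin N) K) - 1)).restrictScalars 𝒪[K]) ≤
      scaleLattice (ϖ ^ e) (latt (g₀ : Matrix (Fin N) (Fin N) K))) : γ = 1 := by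
  have hA : ((g₀⁻¹ * γ * g₀ : GL (Fin N) K) : Matrix (Fin N) (Fin N) K) - 1 = 0 := by
    ext i k
    rw [Matrix.zero_apply]
    by_contra hne
    have hx : Valued.v ((((g₀⁻¹ * γ * g₀ : GL (Fin N) K) : Matrix (Fin N) (Fin N) K) - 1) i k) ≠ 0 := (Valuation.ne_zero_iff _).2 hne
    obtain ⟨n, hn⟩ := exists_pow_lt₀ hϖ1 (Units.mk0 _ hx)
    have hle := (map_sub_one_latt_le_scaleLattice_iff (pow_ne_zero n hϖ) γ g₀).1 (h n) i k
    rw [map_pow] at hle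
    exact absurd (lt_of_lt_of_le hn hle) (lt_irrefl _)
  have hconj : (g₀⁻¹ * γ * g₀ : GL (Fin N) K) = 1 := Units.ext (by rw [Units.val_one]; exact sub_eq_zero.1 hA)
  calc γ = g₀ * (g₀⁻¹ * γ * g₀) * g₀⁻¹ := by group
    _ = 1 := by rw [hconj, mul_one, mul_inv_cancel]

/-- **NEIGHBOURHOOD BASIS — THE `U_M^{(e)}` SHRINK TO `1`**: for `M = latt g₀`, `0 < |ϖ| < 1` and `𝒪` compact, every OPEN `W ∋ 1` of `GL_N(K)` contains the whole level set
`{γ : (γ − 1)·M ⊆ ϖ^e·M}` for some `e ≥ e₀` (any prescribed `e₀`).  PROOF (Cantor): the sets `F_e = U_M^{(e+1)} ∖ W` are closed (open subgroups are closed) in the compact `U_M^{(1)}`,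
decreasing in `e` (★ (U2)), with empty intersection (the previous lemma and `1 ∈ W`); ★ `IsCompact.elim_directed_family_closed` gives one empty `F_e`.
[cite: SchneiderStuhler1997, Ch. I §2] [cite: Korman2004, §3.6] -/
theorem exists_forall_map_sub_one_latt_le_scaleLattice_pow_imp_mem [CompactSpace 𝒪[K]] {ϖ : K} (hϖ : ϖ ≠ 0) (hϖ1 : Valued.v ϖ < 1) (g₀ : GL (Fin N) K)
    {W : Set (GL (Fin N) K)} (hW : IsOpen W) (h1 : (1 : GL (Fin N) K) ∈ W) (e₀ : ℕ) :
    ∃ e : ℕ, e₀ ≤ e ∧ ∀ γ : GL (Fin N) K,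
      (latt (g₀ : Matrix (Fin N) (Fin N) K)).map ((Matrix.toLin' ((γ : Matrix (Fin N) (Fin N) K) - 1)).restrictScalars 𝒪[K]) ≤
        scaleLattice (ϖ ^ e) (latt (g₀ : Matrix (Fin N) (Fin N) K)) → γ ∈ W := by
  -- the decreasing family `V e = U_M^{(e+1)}` of compact open level sets
  set V : ℕ → Set (GL (Fin N) K) := fun e => {γ : GL (Fin N) K | (latt (g₀ : Matrix (Fin N) (Fin N) K)).map ((Matrix.toLin' ((γ : Matrix (Fin N) (Fin N) K) - 1)).restrictScalars 𝒪[K]) ≤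
      scaleLattice (ϖ ^ (e + 1)) (latt (g₀ : Matrix (Fin N) (Fin N) K))} with hVdef
  have hϖle : Valued.v ϖ ≤ 1 := hϖ1.le
  have hpow1 : ∀ e : ℕ, Valued.v (ϖ ^ (e + 1)) < 1 := fun e => by
    rw [map_pow]; exact pow_lt_one₀ zero_le hϖ1 (Nat.succ_ne_zero e)
  have hanti : ∀ {e e' : ℕ}, e ≤ e' → V e' ⊆ V e := fun {e e'} hee' γ hγ =>
    map_sub_one_le_scaleLattice_pow_of_le hϖle (Nat.succ_le_succ hee') hγ
  have hVc : IsCompact (V 0) := isCompact_setOf_map_sub_one_latt_le_scaleLattice (pow_ne_zero _ hϖ) (hpow1 0) g₀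
  have hVcl : ∀ e, IsClosed (V e) := by
    intro e
    obtain ⟨U, hU⟩ := exists_subgroup_mem_iff_map_sub_one_latt_le_scaleLattice (pow_ne_zero (e + 1) hϖ) (hpow1 e) g₀
    have hset : V e = (U : Set (GL (Fin N) K)) := by ext γ; exact (hU γ).symm
    rw [hset]
    exact U.isClosed_of_isOpen (isOpen_coe_of_mem_iff_map_sub_one_latt_le_scaleLattice (pow_ne_zero (e + 1) hϖ) g₀ hU)
  -- Cantor: one `V e ∖ W` is already empty
  have hempty : (V 0 ∩ ⋂ e, (V e ∩ Wᶜ)) = ∅ := by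
    refine Set.eq_empty_iff_forall_notMem.2 fun γ hγ => ?_
    have hall : ∀ e, γ ∈ V e ∩ Wᶜ := Set.mem_iInter.1 hγ.2
    have hγ1 : γ = 1 := by
      refine eq_one_of_forall_map_sub_one_latt_le_scaleLattice_pow hϖ hϖ1 g₀ fun e => ?_
      exact map_sub_one_le_scaleLattice_pow_of_le hϖle (Nat.le_succ e) (hall e).1
    exact (hall 0).2 (hγ1 ▸ h1)
  have hdir : Directed (· ⊇ ·) fun e => V e ∩ Wᶜ := fun a b =>
    ⟨max a b, Set.inter_subset_inter_left _ (hanti (le_max_left a b)), Set.inter_subset_inter_left _ (hanti (le_max_right a b))⟩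
  obtain ⟨e, he⟩ := hVc.elim_directed_family_closed (fun e => V e ∩ Wᶜ) (fun e => (hVcl e).inter hW.isClosed_compl) hempty hdir
  refine ⟨max (e + 1) e₀, le_max_right _ _, fun γ hγ => ?_⟩
  have hγe : γ ∈ V e := map_sub_one_le_scaleLattice_pow_of_le hϖle (le_max_left (e + 1) e₀) hγ
  by_contra hγW
  have hmem : γ ∈ V 0 ∩ (V e ∩ Wᶜ) := ⟨hanti (Nat.zero_le e) hγe, hγe, hγW⟩
  rw [he] at hmem
  exact hmem

/-- **NEIGHBOURHOOD BASIS, filter form**: every `W ∈ 𝓝 1` of `GL_N(K)` contains a level set `{γ : (γ − 1)·latt g₀ ⊆ ϖ^e·latt g₀}` with `e ≥ e₀`.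
[cite: SchneiderStuhler1997, Ch. I §2] [cite: Korman2004, §3.6] -/
theorem exists_forall_map_sub_one_latt_le_scaleLattice_pow_imp_mem_of_mem_nhds [CompactSpace 𝒪[K]] {ϖ : K} (hϖ : ϖ ≠ 0) (hϖ1 : Valued.v ϖ < 1)
    (g₀ : GL (Fin N) K) {W : Set (GL (Fin N) K)} (hW : W ∈ 𝓝 (1 : GL (Fin N) K)) (e₀ : ℕ) :
    ∃ e : ℕ, e₀ ≤ e ∧ ∀ γ : GL (Fin N) K,
      (latt (g₀ : Matrix (Fin N) (Fin N) K)).map ((Matrix.toLin' ((γ : Matrix (Fin N) (Fin N) K) - 1)).restrictScalars 𝒪[K]) ≤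
        scaleLattice (ϖ ^ e) (latt (g₀ : Matrix (Fin N) (Fin N) K)) → γ ∈ W := by
  obtain ⟨O, hOW, hO, h1⟩ := mem_nhds_iff.1 hW
  obtain ⟨e, he, h⟩ := exists_forall_map_sub_one_latt_le_scaleLattice_pow_imp_mem hϖ hϖ1 g₀ hO h1 e₀
  exact ⟨e, he, fun γ hγ => hOW (h γ hγ)⟩

/-- **(iii) ONE LEVEL GROUP INSIDE FINITELY MANY OPENS**: for a finite family `W i` of opens of `GL_N(K)` each containing `1`, some level set `{γ : (γ − 1)·latt g₀ ⊆ ϖ^e·latt g₀}`,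
`e ≥ e₀`, lies in all of them (apply the basis to `⋂ i, W i`); with `e₀` the consumer also keeps it inside a prescribed `U_M^{(e₀)}` ∕ compact open `P ⊇ U_M^{(e₀)}` (★ (U2)).
[cite: Korman2004, §5 Claim 39] [cite: SchneiderStuhler1997, Ch. I §2] -/
theorem exists_forall_map_sub_one_latt_le_scaleLattice_pow_imp_mem_forall_of_finite [CompactSpace 𝒪[K]] {ϖ : K} (hϖ : ϖ ≠ 0) (hϖ1 : Valued.v ϖ < 1)
    (g₀ : GL (Fin N) K) {ι : Type*} [Finite ι] (W : ι → Set (GL (Fin N) K)) (hW : ∀ i, IsOpen (W i)) (h1 : ∀ i, (1 : GL (Fin N) K) ∈ W i) (e₀ : ℕ) :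
    ∃ e : ℕ, e₀ ≤ e ∧ ∀ i, ∀ γ : GL (Fin N) K,
      (latt (g₀ : Matrix (Fin N) (Fin N) K)).map ((Matrix.toLin' ((γ : Matrix (Fin N) (Fin N) K) - 1)).restrictScalars 𝒪[K]) ≤
        scaleLattice (ϖ ^ e) (latt (g₀ : Matrix (Fin N) (Fin N) K)) → γ ∈ W i := by
  obtain ⟨e, he, h⟩ := exists_forall_map_sub_one_latt_le_scaleLattice_pow_imp_mem hϖ hϖ1 g₀ (isOpen_iInter_of_finite hW) (Set.mem_iInter.2 h1) e₀
  exact ⟨e, he, fun i γ hγ => Set.mem_iInter.1 (h γ hγ) i⟩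

/-! ## §4 THE UNITARY RESTRICTION `U(σ, H) ≤ GL_N(K)` inherits (i)–(iii) -/

section Unitary

variable (σ : K →+* K) (H : Matrix (Fin N) (Fin N) K)

/-- **(iv) OPEN**: the trace on `U(σ,H)` of the pure level set of `latt g₀` is open (`c ≠ 0`). [cite: SchneiderStuhler1997, Ch. I §2] [cite: Tits1979, §3.2] -/
theorem isOpen_preimage_val_setOf_map_sub_one_latt_le_scaleLattice {c : K} (hc : c ≠ 0) (g₀ : GL (Fin N) K) :
    IsOpen ((Subtype.val : ↥(unitaryGroupOfForm σ H) → GL (Fin N) K) ⁻¹'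
      {γ : GL (Fin N) K | (latt (g₀ : Matrix (Fin N) (Fin N) K)).map ((Matrix.toLin' ((γ : Matrix (Fin N) (Fin N) K) - 1)).restrictScalars 𝒪[K]) ≤
        scaleLattice c (latt (g₀ : Matrix (Fin N) (Fin N) K))}) :=
  (isOpen_setOf_map_sub_one_latt_le_scaleLattice hc g₀).preimage continuous_subtype_val

/-- **(iv) COMPACT**: the trace on `U(σ,H)` of the pure level set of `latt g₀` is compact (`0 < |c| < 1`, `𝒪` compact, `σ` continuous: `U(σ,H)` is closed in `GL_N(K)`,
★ `isClosed_unitaryGroupOfForm`, so `Subtype.val` is a closed embedding). [cite: SchneiderStuhler1997, Ch. I §2] [cite: Tits1979, §3.2] -/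
theorem isCompact_preimage_val_setOf_map_sub_one_latt_le_scaleLattice [CompactSpace 𝒪[K]] (hσ : Continuous σ) {c : K} (hc : c ≠ 0) (hc1 : Valued.v c < 1)
    (g₀ : GL (Fin N) K) :
    IsCompact ((Subtype.val : ↥(unitaryGroupOfForm σ H) → GL (Fin N) K) ⁻¹'
      {γ : GL (Fin N) K | (latt (g₀ : Matrix (Fin N) (Fin N) K)).map ((Matrix.toLin' ((γ : Matrix (Fin N) (Fin N) K) - 1)).restrictScalars 𝒪[K]) ≤
        scaleLattice c (latt (g₀ : Matrix (Fin N) (Fin N) K))}) :=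
  (isClosed_unitaryGroupOfForm hσ H).isClosedEmbedding_subtypeVal.isCompact_preimage (isCompact_setOf_map_sub_one_latt_le_scaleLattice hc hc1 g₀)

/-- **(iv) OPEN, subgroup spelling**: a subgroup of `U(σ,H)` cut out by the pure level token of `latt g₀` on the underlying matrices is open (`c ≠ 0`).
[cite: SchneiderStuhler1997, Ch. I §2] [cite: BruhatTits1972, §10] -/
theorem isOpen_coe_of_mem_iff_map_sub_one_latt_le_scaleLattice_unitary {c : K} (hc : c ≠ 0) (g₀ : GL (Fin N) K) {U : Subgroup ↥(unitaryGroupOfForm σ H)}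
    (hU : ∀ u : ↥(unitaryGroupOfForm σ H), u ∈ U ↔
      (latt (g₀ : Matrix (Fin N) (Fin N) K)).map ((Matrix.toLin' (((u : GL (Fin N) K) : Matrix (Fin N) (Fin N) K) - 1)).restrictScalars 𝒪[K]) ≤
        scaleLattice c (latt (g₀ : Matrix (Fin N) (Fin N) K))) :
    IsOpen (U : Set ↥(unitaryGroupOfForm σ H)) := by
  have hset : (U : Set ↥(unitaryGroupOfForm σ H)) = (Subtype.val : ↥(unitaryGroupOfForm σ H) → GL (Fin N) K) ⁻¹'
      {γ : GL (Fin N) K | (latt (g₀ : Matrix (Fin N) (Fin N) K)).map ((Matrix.toLin' ((γ : Matrix (Fin N) (Fin N) K) - 1)).restrictScalars 𝒪[K]) ≤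
        scaleLattice c (latt (g₀ : Matrix (Fin N) (Fin N) K))} := by
    ext u; exact hU u
  rw [hset]
  exact isOpen_preimage_val_setOf_map_sub_one_latt_le_scaleLattice σ H hc g₀

/-- **(iv) COMPACT, subgroup spelling** (`0 < |c| < 1`, `𝒪` compact, `σ` continuous). [cite: SchneiderStuhler1997, Ch. I §2] [cite: Tits1979, §3.2] -/
theorem isCompact_coe_of_mem_iff_map_sub_one_latt_le_scaleLattice_unitary [CompactSpace 𝒪[K]] (hσ : Continuous σ) {c : K} (hc : c ≠ 0) (hc1 : Valued.v c < 1)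
    (g₀ : GL (Fin N) K) {U : Subgroup ↥(unitaryGroupOfForm σ H)}
    (hU : ∀ u : ↥(unitaryGroupOfForm σ H), u ∈ U ↔
      (latt (g₀ : Matrix (Fin N) (Fin N) K)).map ((Matrix.toLin' (((u : GL (Fin N) K) : Matrix (Fin N) (Fin N) K) - 1)).restrictScalars 𝒪[K]) ≤
        scaleLattice c (latt (g₀ : Matrix (Fin N) (Fin N) K))) :
    IsCompact (U : Set ↥(unitaryGroupOfForm σ H)) := by
  have hset : (U : Set ↥(unitaryGroupOfForm σ H)) = (Subtype.val : ↥(unitaryGroupOfForm σ H) → GL (Fin N) K) ⁻¹'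
      {γ : GL (Fin N) K | (latt (g₀ : Matrix (Fin N) (Fin N) K)).map ((Matrix.toLin' ((γ : Matrix (Fin N) (Fin N) K) - 1)).restrictScalars 𝒪[K]) ≤
        scaleLattice c (latt (g₀ : Matrix (Fin N) (Fin N) K))} := by
    ext u; exact hU u
  rw [hset]
  exact isCompact_preimage_val_setOf_map_sub_one_latt_le_scaleLattice σ H hσ hc hc1 g₀

/-- **(iv) NEIGHBOURHOOD BASIS IN `U(σ,H)`**: every open `W ∋ 1` of the unitary group contains all `u ∈ U(σ,H)` of level `ϖ^e` on `latt g₀` for some `e ≥ e₀` (`0 < |ϖ| < 1`,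
`𝒪` compact) — `W` is the trace of an open of `GL_N(K)` (subspace topology), to which §3 applies. [cite: SchneiderStuhler1997, Ch. I §2] [cite: Korman2004, §5 Claim 39] -/
theorem exists_forall_map_sub_one_latt_le_scaleLattice_pow_imp_mem_unitary [CompactSpace 𝒪[K]] {ϖ : K} (hϖ : ϖ ≠ 0) (hϖ1 : Valued.v ϖ < 1) (g₀ : GL (Fin N) K)
    {W : Set ↥(unitaryGroupOfForm σ H)} (hW : IsOpen W) (h1 : (1 : ↥(unitaryGroupOfForm σ H)) ∈ W) (e₀ : ℕ) :
    ∃ e : ℕ, e₀ ≤ e ∧ ∀ u : ↥(unitaryGroupOfForm σ H),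
      (latt (g₀ : Matrix (Fin N) (Fin N) K)).map ((Matrix.toLin' (((u : GL (Fin N) K) : Matrix (Fin N) (Fin N) K) - 1)).restrictScalars 𝒪[K]) ≤
        scaleLattice (ϖ ^ e) (latt (g₀ : Matrix (Fin N) (Fin N) K)) → u ∈ W := by
  obtain ⟨O, hO, hOW⟩ := isOpen_induced_iff.1 hW
  have h1O : (1 : GL (Fin N) K) ∈ O := by
    have h : (1 : ↥(unitaryGroupOfForm σ H)) ∈ Subtype.val ⁻¹' O := by rw [hOW]; exact h1
    exact h
  obtain ⟨e, he, h⟩ := exists_forall_map_sub_one_latt_le_scaleLattice_pow_imp_mem hϖ hϖ1 g₀ hO h1O e₀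
  refine ⟨e, he, fun u hu => ?_⟩
  rw [← hOW]
  exact h (u : GL (Fin N) K) hu

/-- **(iv) ONE LEVEL GROUP OF `U(σ,H)` INSIDE FINITELY MANY OPENS** (the datum shape of 41c's `𝒲`): for a finite family of opens `W i ∋ 1` of `U(σ,H)` some level `ϖ^e`, `e ≥ e₀`,
of `latt g₀` puts every unitary element of that level inside all `W i`. [cite: Korman2004, §5 Claim 39] [cite: SchneiderStuhler1997, Ch. I §2] -/
theorem exists_forall_map_sub_one_latt_le_scaleLattice_pow_imp_mem_forall_of_finite_unitary [CompactSpace 𝒪[K]] {ϖ : K} (hϖ : ϖ ≠ 0) (hϖ1 : Valued.v ϖ < 1)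
    (g₀ : GL (Fin N) K) {ι : Type*} [Finite ι] (W : ι → Set ↥(unitaryGroupOfForm σ H)) (hW : ∀ i, IsOpen (W i)) (h1 : ∀ i, (1 : ↥(unitaryGroupOfForm σ H)) ∈ W i)
    (e₀ : ℕ) :
    ∃ e : ℕ, e₀ ≤ e ∧ ∀ i, ∀ u : ↥(unitaryGroupOfForm σ H),
      (latt (g₀ : Matrix (Fin N) (Fin N) K)).map ((Matrix.toLin' (((u : GL (Fin N) K) : Matrix (Fin N) (Fin N) K) - 1)).restrictScalars 𝒪[K]) ≤
        scaleLattice (ϖ ^ e) (latt (g₀ : Matrix (Fin N) (Fin N) K)) → u ∈ W i := by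
  obtain ⟨e, he, h⟩ := exists_forall_map_sub_one_latt_le_scaleLattice_pow_imp_mem_unitary σ H hϖ hϖ1 g₀ (isOpen_iInter_of_finite hW) (Set.mem_iInter.2 h1) e₀
  exact ⟨e, he, fun i u hu => Set.mem_iInter.1 (h u hu) i⟩

end Unitary

end Literature.NumberTheory.Automorphic.UnitaryLatticeTree

end
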